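import Mathlib
import Summits.AnomalousDissipation.AnomalousDissipation.Theorems.MomentParityQuarticGateAxialQuadKill

/-!
# Axial quadratic rigidity (stub S2q of line `axis-sectors`, crux `MomentParity.QuarticGate`):
# the per-triad identity and the two peeling steps of the centre sector

The finite linear algebra behind Kraichnan's statement "`E` and `H` are the only quadratic invariants
of ball-truncated 3-D Euler", in the complexified block language of this stub. The unknown is a family
of complex `3 × 3` blocks `Q a b` (`a, b ∈ ℤ³`) — the Hessian blocks of a quadratic observable in the
Fourier amplitudes — with `Q b a = (Q a b)ᵀ`, `aᵀ Q a b = 0`, `Q a b b = 0`, subject to the polarised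
single-triad identity `(POL)`:
`W₁₂ᵀ Q (k₁+k₂) k₃ v₃ + W₁₃ᵀ Q (k₁+k₃) k₂ v₂ + W₂₃ᵀ Q (k₂+k₃) k₁ v₁ = 0` for all wavevector triples and
transverse amplitudes `vᵢ ⊥ kᵢ`, `Wᵢⱼ = (vᵢ·kⱼ) vⱼ + (vⱼ·kᵢ) vᵢ` the pair transfer. The CENTRE blocks
are `A_k = Q (-k) k`; `k` is PINNED to `(α, β)` when `A_k y = α y + β k × y` on `k⊥`.

* `triad_T` — `(POL)` on a closed triad `k₃ = -(k₁ + k₂)`, oriented on the centre blocks;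
* `refTriad` — the reference family `y ↦ α y + β k × y` (energy and helicity) satisfies the triad
  identity (a polynomial identity: the helicity part vanishes identically);
* `pinned_neg` — `k` pinned ⇒ `-k` pinned;
* `pinned_of_unequal_pair` — THE UNEQUAL PEELING STEP: `k₁, k₂` pinned, `k₁ ∦ k₂`, `|k₁| ≠ |k₂|`
  ⇒ `k₁ + k₂` pinned (block-killing lemma `matrix_eq_zero_of_forall_pair_transfer`'s vector form);
* `normal_step_of_equal_pair`, `pinned_of_two_equal_pairs` — THE EQUAL PEELING STEP: an equal pair
  pins the polarisation `k₁ × k₂` only; two equal pairs with independent normals pin `k₁ + k₂`.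
-/

namespace Summit.AnomalousDissipation.AnomalousDissipation.Theorems.MomentParityQuarticGate.AxialQuad

open Matrix

-- `Summit.<Summit>.<Problem>` is the tree's mandated summit-side namespace (CONVENTIONS §2); for this
-- single-conjunct summit the two coincide, so the duplicate is deliberate.
set_option linter.dupNamespace false

variable (Q : (Fin 3 → ℤ) → (Fin 3 → ℤ) → Matrix (Fin 3) (Fin 3) ℂ) {N : ℕ}

/-- The punctured ball is symmetric under `k ↦ -k`. [folklore] -/
theorem ball_neg {N : ℕ} {k : Fin 3 → ℤ} (hk : ((k : Fin 3 → ℤ) ≠ 0 ∧ (k) ⬝ᵥ (k) ≤ ((N : ℕ) : ℤ) ^ 2)) : ((-k : Fin 3 → ℤ) ≠ 0 ∧ (-k) ⬝ᵥ (-k) ≤ ((N : ℕ) : ℤ) ^ 2) :=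
  ⟨neg_ne_zero.2 hk.1, by simpa using hk.2⟩

/-- **`(POL)` on a closed triad, oriented on centre blocks.** For `k₃ = -(k₁+k₂)`:
`W₁₂ᵀ (A_{k₁+k₂})ᵀ v₃ + W₁₃ᵀ A_{k₂} v₂ + W₂₃ᵀ A_{k₁} v₁ = 0`, `A_k = Q (-k) k`. [folklore] -/
theorem triad_T (hsymm : ∀ a b, Q b a = (Q a b)ᵀ) (hpol : (∀ (k₁ k₂ k₃ : Fin 3 → ℤ) (v₁ v₂ v₃ : Fin 3 → ℂ), ((k₁ : Fin 3 → ℤ) ≠ 0 ∧ (k₁) ⬝ᵥ (k₁) ≤ ((N : ℕ) : ℤ) ^ 2) → ((k₂ : Fin 3 → ℤ) ≠ 0 ∧ (k₂) ⬝ᵥ (k₂) ≤ ((N : ℕ) : ℤ) ^ 2) → ((k₃ : Fin 3 → ℤ) ≠ 0 ∧ (k₃) ⬝ᵥ (k₃) ≤ ((N : ℕ) : ℤ) ^ 2) → v₁ ⬝ᵥ (fun i : Fin 3 => (((k₁ : Fin 3 → ℤ) i : ℤ) : ℂ)) = 0 → v₂ ⬝ᵥ (fun i : Fin 3 => (((k₂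 : Fin 3 → ℤ) i : ℤ) : ℂ)) = 0 → v₃ ⬝ᵥ (fun i : Fin 3 => (((k₃ : Fin 3 → ℤ) i : ℤ) : ℂ)) = 0 → (((v₁) ⬝ᵥ (fun i : Fin 3 => (((k₂ : Fin 3 → ℤ) i : ℤ) : ℂ))) • (v₂) + ((v₂) ⬝ᵥ (fun i : Fin 3 => (((k₁ : Fin 3 → ℤ) i : ℤ) : ℂ))) • (v₁) : Fin 3 → ℂ) ⬝ᵥ (Q (k₁ + k₂) k₃ *ᵥ v₃) + (((v₁) ⬝ᵥ (fun i : Fin 3 => (((k₃ : Fin 3 → ℤ) i : ℤ) : ℂ))) • (v₃) + ((v₃) ⬝ᵥ (fun i : Fin 3 => (((k₁ : Fin 3 → ℤ) i : ℤ) : ℂ))) • (v₁) : Fin 3 → ℂ) ⬝ᵥ (Q (k₁ + k₃) k₂ *ᵥ v₂) + (((v₂) ⬝ᵥ (fun i : Fin 3 => (((k₃ : Fin 3 → ℤ) i : ℤ) : ℂ))) • (v₃) + ((v₃) ⬝ᵥ (fun i : Fin 3 => (((k₂ : Fin 3 → ℤ) i : ℤ) : ℂ))) • (v₂) : Fin 3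 → ℂ) ⬝ᵥ (Q (k₂ + k₃) k₁ *ᵥ v₁) = 0)) (k₁ k₂ : Fin 3 → ℤ)
    (hk₁ : ((k₁ : Fin 3 → ℤ) ≠ 0 ∧ (k₁) ⬝ᵥ (k₁) ≤ ((N : ℕ) : ℤ) ^ 2)) (hk₂ : ((k₂ : Fin 3 → ℤ) ≠ 0 ∧ (k₂) ⬝ᵥ (k₂) ≤ ((N : ℕ) : ℤ) ^ 2)) (hk₁₂ : ((k₁ + k₂ : Fin 3 → ℤ) ≠ 0 ∧ (k₁ + k₂) ⬝ᵥ (k₁ + k₂) ≤ ((N : ℕ) : ℤ) ^ 2))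
    (v₁ v₂ v₃ : Fin 3 → ℂ) (h₁ : v₁ ⬝ᵥ (fun i : Fin 3 => (((k₁ : Fin 3 → ℤ) i : ℤ) : ℂ)) = 0) (h₂ : v₂ ⬝ᵥ (fun i : Fin 3 => (((k₂ : Fin 3 → ℤ) i : ℤ) : ℂ)) = 0)
    (h₃ : v₃ ⬝ᵥ (fun i : Fin 3 => ((((k₁ + k₂) : Fin 3 → ℤ) i : ℤ) : ℂ)) = 0) :
    (((v₁) ⬝ᵥ (fun i : Fin 3 => (((k₂ : Fin 3 → ℤ) i : ℤ) : ℂ))) • (v₂) + ((v₂) ⬝ᵥ (fun i : Fin 3 => (((k₁ : Fin 3 → ℤ) i : ℤ) : ℂ))) • (v₁) : Fin 3 → ℂ) ⬝ᵥ ((Q (-(k₁ + k₂)) (k₁ + k₂))ᵀ *ᵥ v₃) +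
      (((v₁) ⬝ᵥ (fun i : Fin 3 => (((-(k₁ + k₂) : Fin 3 → ℤ) i : ℤ) : ℂ))) • (v₃) + ((v₃) ⬝ᵥ (fun i : Fin 3 => (((k₁ : Fin 3 → ℤ) i : ℤ) : ℂ))) • (v₁) : Fin 3 → ℂ) ⬝ᵥ (Q (-k₂) k₂ *ᵥ v₂) +
      (((v₂) ⬝ᵥ (fun i : Fin 3 => (((-(k₁ + k₂) : Fin 3 → ℤ) i : ℤ) : ℂ))) • (v₃) + ((v₃) ⬝ᵥ (fun i : Fin 3 => (((k₂ : Fin 3 → ℤ) i : ℤ) : ℂ))) • (v₂) : Fin 3 → ℂ) ⬝ᵥ (Q (-k₁) k₁ *ᵥ v₁) = 0 := by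
  have h₃' : v₃ ⬝ᵥ (fun i : Fin 3 => ((((-(k₁ + k₂)) : Fin 3 → ℤ) i : ℤ) : ℂ)) = 0 := by rw [castVec_neg, dotProduct_neg, h₃, neg_zero]
  have h := hpol k₁ k₂ (-(k₁ + k₂)) v₁ v₂ v₃ hk₁ hk₂ (ball_neg hk₁₂) h₁ h₂ h₃'
  have e1 : k₁ + -(k₁ + k₂) = -k₂ := by abel
  have e2 : k₂ + -(k₁ + k₂) = -k₁ := by abel
  rw [e1, e2, hsymm (-(k₁ + k₂)) (k₁ + k₂)] at h
  exact h

/-- **The reference family satisfies the triad identity.** For `k₁ + k₂ + k₃ = 0` and `vᵢ ⊥ kᵢ`,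
`Σ_cyc W₁₂ · (α v₃ + β k₃ × v₃) = 0` — energy and helicity are conserved triad by triad (the `α`
part is `-Σ (vⱼ·vₗ)(vᵢ·kᵢ)`, the `β` part vanishes identically as a polynomial). [folklore] -/
theorem refTriad (α β : ℂ) (k₁ k₂ k₃ : Fin 3 → ℤ) (hk : k₃ = -(k₁ + k₂)) (v₁ v₂ v₃ : Fin 3 → ℂ)
    (h₁ : v₁ ⬝ᵥ (fun i : Fin 3 => (((k₁ : Fin 3 → ℤ) i : ℤ) : ℂ)) = 0) (h₂ : v₂ ⬝ᵥ (fun i : Fin 3 => (((k₂ : Fin 3 → ℤ) i : ℤ) : ℂ)) = 0) (h₃ : v₃ ⬝ᵥ (fun i : Fin 3 => (((k₃ : Fin 3 → ℤ) i : ℤ) : ℂ)) = 0) :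
    (((v₁) ⬝ᵥ (fun i : Fin 3 => (((k₂ : Fin 3 → ℤ) i : ℤ) : ℂ))) • (v₂) + ((v₂) ⬝ᵥ (fun i : Fin 3 => (((k₁ : Fin 3 → ℤ) i : ℤ) : ℂ))) • (v₁) : Fin 3 → ℂ) ⬝ᵥ (α • v₃ + β • ((fun i : Fin 3 => (((k₃ : Fin 3 → ℤ) i : ℤ) : ℂ)) ⨯₃ v₃)) +
      (((v₁) ⬝ᵥ (fun i : Fin 3 => (((k₃ : Fin 3 → ℤ) i : ℤ) : ℂ))) • (v₃) + ((v₃) ⬝ᵥ (fun i : Fin 3 => (((k₁ : Fin 3 → ℤ) i : ℤ) : ℂ))) • (v₁) : Fin 3 → ℂ) ⬝ᵥ (α • v₂ + β • ((fun i : Fin 3 => (((k₂ : Fin 3 → ℤ) i : ℤ) : ℂ)) ⨯₃ v₂)) +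
      (((v₂) ⬝ᵥ (fun i : Fin 3 => (((k₃ : Fin 3 → ℤ) i : ℤ) : ℂ))) • (v₃) + ((v₃) ⬝ᵥ (fun i : Fin 3 => (((k₂ : Fin 3 → ℤ) i : ℤ) : ℂ))) • (v₂) : Fin 3 → ℂ) ⬝ᵥ (α • v₁ + β • ((fun i : Fin 3 => (((k₁ : Fin 3 → ℤ) i : ℤ) : ℂ)) ⨯₃ v₁)) = 0 := by
  subst hk
  simp only [dotProduct, Fin.sum_univ_three, cross_apply, Pi.add_apply, Pi.smul_apply, Pi.neg_apply,
    smul_eq_mul, Matrix.cons_val_zero, Matrix.cons_val_one, Matrix.cons_val_two, Matrix.head_cons,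
    Matrix.tail_cons, Int.cast_add, Int.cast_neg] at h₁ h₂ h₃ ⊢
  linear_combination
    (-α * (v₂ 0 * v₃ 0 + v₂ 1 * v₃ 1 + v₂ 2 * v₃ 2)) * h₁ +
    (-α * (v₁ 0 * v₃ 0 + v₁ 1 * v₃ 1 + v₁ 2 * v₃ 2)) * h₂ +
    (-α * (v₁ 0 * v₂ 0 + v₁ 1 * v₂ 1 + v₁ 2 * v₂ 2)) * h₃

/-- A vector orthogonal (bilinear dot product) to `k⊥` and to a nonzero integer `k` vanishes.
[folklore] -/
theorem eq_zero_of_dotProduct_transverse (k : Fin 3 → ℤ) (hk : k ≠ 0) (z : Fin 3 → ℂ)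
    (hz : ∀ x : Fin 3 → ℂ, x ⬝ᵥ (fun i : Fin 3 => (((k : Fin 3 → ℤ) i : ℤ) : ℂ)) = 0 → x ⬝ᵥ z = 0) (hkz : (fun i : Fin 3 => (((k : Fin 3 → ℤ) i : ℤ) : ℂ)) ⬝ᵥ z = 0) : z = 0 := by
  have hall : ∀ x : Fin 3 → ℂ, x ⬝ᵥ z = 0 := fun x => by
    obtain ⟨x', t, hx', rfl⟩ := exists_transverse_add_smul k hk x
    rw [add_dotProduct, smul_dotProduct, hz x' hx', hkz, smul_zero, add_zero]
  funext i
  simpa [dotProduct, Pi.single_apply, Fin.sum_univ_three] using hall (Pi.single i 1)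

/-- **Pinned vectors come in pairs**: `k` pinned ⇒ `-k` pinned (`A_{-k} = A_kᵀ`). [folklore] -/
theorem pinned_neg (hsymm : ∀ a b, Q b a = (Q a b)ᵀ) (hcol : ∀ a b, Q a b *ᵥ (fun i : Fin 3 => (((b : Fin 3 → ℤ) i : ℤ) : ℂ)) = 0)
    {α β : ℂ} {k : Fin 3 → ℤ} (hk : k ≠ 0) (h : (∀ y : Fin 3 → ℂ, y ⬝ᵥ (fun i : Fin 3 => (((k : Fin 3 → ℤ) i : ℤ) : ℂ)) = 0 → Q (-(k)) (k) *ᵥ y = (α) • y + (β) • ((fun i : Fin 3 => (((k : Fin 3 → ℤ) i : ℤ) : ℂ)) ⨯₃ y))) : (∀ y : Fin 3 → ℂ, y ⬝ᵥ (fun i : Fin 3 => (((-k : Fin 3 → ℤ) i : ℤ) : ℂ)) = 0 → Q (-(-k)) (-k) *ᵥ y = (α) • y + (β) • ((fun i : Fin 3 => (((-k : Fin 3 → ℤ) i : ℤ) : ℂ)) ⨯₃ y)) := by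
  intro y hy
  rw [castVec_neg, dotProduct_neg, neg_eq_zero] at hy
  rw [neg_neg, hsymm (-k) k]
  -- `z := A_kᵀ y - (α y + β (-k) × y)` is orthogonal to `k⊥` and to `k`
  have hz := eq_zero_of_dotProduct_transverse k hk
    ((Q (-k) k)ᵀ *ᵥ y - (α • y + β • ((fun i : Fin 3 => ((((-k) : Fin 3 → ℤ) i : ℤ) : ℂ)) ⨯₃ y))) (fun x hx => ?_) ?_
  · exact sub_eq_zero.1 hz
  · rw [dotProduct_sub, Matrix.mulVec_transpose, dotProduct_comm x (y ᵥ* _), ← Matrix.dotProduct_mulVec,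
      h x hx, castVec_neg, dotProduct_add, dotProduct_add, dotProduct_smul, dotProduct_smul,
      dotProduct_smul, dotProduct_smul, smul_eq_mul, smul_eq_mul, smul_eq_mul, smul_eq_mul,
      dotProduct_comm y x, LinearMap.map_neg₂, dotProduct_neg]
    have : y ⬝ᵥ (fun i : Fin 3 => (((k : Fin 3 → ℤ) i : ℤ) : ℂ)) ⨯₃ x = -(x ⬝ᵥ (fun i : Fin 3 => (((k : Fin 3 → ℤ) i : ℤ) : ℂ)) ⨯₃ y) := by
      rw [triple_product_permutation, triple_product_permutation, ← cross_anticomm, dotProduct_neg,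
        triple_product_permutation]
    rw [this]; ring
  · rw [dotProduct_sub, Matrix.mulVec_transpose, dotProduct_comm _ (y ᵥ* _), ← Matrix.dotProduct_mulVec,
      hcol, dotProduct_zero, castVec_neg, dotProduct_add, dotProduct_smul, dotProduct_smul, smul_eq_mul,
      smul_eq_mul, dotProduct_comm _ y, hy, LinearMap.map_neg₂, dotProduct_neg, dot_self_cross]
    ring

/-- **THE UNEQUAL PEELING STEP.** If `k₁, k₂` are pinned to `(α, β)`, `k₁ × k₂ ≠ 0` and
`|k₁|² ≠ |k₂|²`, then `-(k₁ + k₂)` is pinned: subtracting the reference family from `(POL)` leaves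
`W₁₂ · (A_{k₃} v₃ - α v₃ - β k₃ × v₃) = 0` for all pair transfers, and these project onto `k₃⊥`.
[folklore] -/
theorem pinned_of_unequal_pair (hrow : ∀ a b, (fun i : Fin 3 => (((a : Fin 3 → ℤ) i : ℤ) : ℂ)) ᵥ* Q a b = 0) (hpol : (∀ (k₁ k₂ k₃ : Fin 3 → ℤ) (v₁ v₂ v₃ : Fin 3 → ℂ), ((k₁ : Fin 3 → ℤ) ≠ 0 ∧ (k₁) ⬝ᵥ (k₁) ≤ ((N : ℕ) : ℤ) ^ 2) → ((k₂ : Fin 3 → ℤ) ≠ 0 ∧ (k₂) ⬝ᵥ (k₂) ≤ ((N : ℕ) : ℤ) ^ 2) → ((k₃ : Fin 3 → ℤ) ≠ 0 ∧ (k₃) ⬝ᵥ (k₃) ≤ ((N : ℕ) : ℤ) ^ 2) → v₁ ⬝ᵥ (fun i : Fin 3 => (((k₁ : Fin 3 → ℤ) i : ℤ) : ℂ)) = 0 → v₂ ⬝ᵥ (fun i : Fin 3 => (((k₂ : Fin 3 → ℤ) i : ℤ) : ℂ)) = 0 → v₃ ⬝ᵥ (fun i : Fin 3 => (((k₃ :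 Fin 3 → ℤ) i : ℤ) : ℂ)) = 0 → (((v₁) ⬝ᵥ (fun i : Fin 3 => (((k₂ : Fin 3 → ℤ) i : ℤ) : ℂ))) • (v₂) + ((v₂) ⬝ᵥ (fun i : Fin 3 => (((k₁ : Fin 3 → ℤ) i : ℤ) : ℂ))) • (v₁) : Fin 3 → ℂ) ⬝ᵥ (Q (k₁ + k₂) k₃ *ᵥ v₃) + (((v₁) ⬝ᵥ (fun i : Fin 3 => (((k₃ : Fin 3 → ℤ) i : ℤ) : ℂ))) • (v₃) + ((v₃) ⬝ᵥ (fun i : Fin 3 => (((k₁ : Fin 3 → ℤ) i : ℤ) : ℂ))) • (v₁) : Fin 3 → ℂ) ⬝ᵥ (Q (k₁ + k₃) k₂ *ᵥ v₂) + (((v₂) ⬝ᵥ (fun i : Fin 3 => (((k₃ : Fin 3 → ℤ) i : ℤ) : ℂ))) • (v₃) + ((v₃) ⬝ᵥ (fun i : Fin 3 => (((k₂ : Fin 3 → ℤ) i : ℤ) : ℂ))) • (v₂) : Fin 3 → ℂ) ⬝ᵥ (Q (k₂ + k₃) k₁ *ᵥ v₁) = 0)) {α β : ℂ}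
    {k₁ k₂ : Fin 3 → ℤ} (hk₁ : ((k₁ : Fin 3 → ℤ) ≠ 0 ∧ (k₁) ⬝ᵥ (k₁) ≤ ((N : ℕ) : ℤ) ^ 2)) (hk₂ : ((k₂ : Fin 3 → ℤ) ≠ 0 ∧ (k₂) ⬝ᵥ (k₂) ≤ ((N : ℕ) : ℤ) ^ 2)) (hk₁₂ : ((k₁ + k₂ : Fin 3 → ℤ) ≠ 0 ∧ (k₁ + k₂) ⬝ᵥ (k₁ + k₂) ≤ ((N : ℕ) : ℤ) ^ 2))
    (hn : k₁ ⨯₃ k₂ ≠ 0) (hlen : k₁ ⬝ᵥ k₁ ≠ k₂ ⬝ᵥ k₂)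
    (h₁ : (∀ y : Fin 3 → ℂ, y ⬝ᵥ (fun i : Fin 3 => (((k₁ : Fin 3 → ℤ) i : ℤ) : ℂ)) = 0 → Q (-(k₁)) (k₁) *ᵥ y = (α) • y + (β) • ((fun i : Fin 3 => (((k₁ : Fin 3 → ℤ) i : ℤ) : ℂ)) ⨯₃ y))) (h₂ : (∀ y : Fin 3 → ℂ, y ⬝ᵥ (fun i : Fin 3 => (((k₂ : Fin 3 → ℤ) i : ℤ) : ℂ)) = 0 → Q (-(k₂)) (k₂) *ᵥ y = (α) • y + (β) • ((fun i : Fin 3 => (((k₂ : Fin 3 → ℤ) i : ℤ) : ℂ)) ⨯₃ y))) : (∀ y : Fin 3 → ℂ, y ⬝ᵥ (fun i : Fin 3 => (((-(k₁ + k₂) : Fin 3 → ℤ) i : ℤ) : ℂ)) = 0 → Q (-(-(k₁ + k₂))) (-(k₁ + k₂)) *ᵥ y = (α) • y + (β) • ((fun i : Fin 3 => (((-(k₁ + k₂) : Fin 3 → ℤ) i : ℤ) : ℂ)) ⨯₃ y)) := by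
  intro y hy
  set k₃ := -(k₁ + k₂) with hk₃
  have hsum : k₁ + k₂ = -k₃ := by rw [hk₃, neg_neg]
  -- the defect vector
  set z : Fin 3 → ℂ := Q (-k₃) k₃ *ᵥ y - (α • y + β • ((fun i : Fin 3 => (((k₃ : Fin 3 → ℤ) i : ℤ) : ℂ)) ⨯₃ y)) with hz
  suffices hz0 : z = 0 from sub_eq_zero.1 hz0
  have hn' : ((fun i : Fin 3 => (((k₁ : Fin 3 → ℤ) i : ℤ) : ℂ)) ⨯₃ (fun i : Fin 3 => (((k₂ : Fin 3 → ℤ) i : ℤ) : ℂ))) ⬝ᵥ ((fun i : Fin 3 => (((k₁ : Fin 3 → ℤ) i : ℤ) : ℂ)) ⨯₃ (fun i : Fin 3 => (((k₂ : Fin 3 → ℤ) i : ℤ) : ℂ))) ≠ 0 := by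
    rw [castVec_cross_castVec]; exact castVec_dotProduct_self_ne_zero hn
  have hlen' : (fun i : Fin 3 => (((k₁ : Fin 3 → ℤ) i : ℤ) : ℂ)) ⬝ᵥ (fun i : Fin 3 => (((k₁ : Fin 3 → ℤ) i : ℤ) : ℂ)) ≠ (fun i : Fin 3 => (((k₂ : Fin 3 → ℤ) i : ℤ) : ℂ)) ⬝ᵥ (fun i : Fin 3 => (((k₂ : Fin 3 → ℤ) i : ℤ) : ℂ)) := by
    rw [castVec_dotProduct_castVec, castVec_dotProduct_castVec]; exact_mod_cast hlen
  refine eq_zero_of_forall_pair_transfer_complex ((fun i : Fin 3 => (((k₁ : Fin 3 → ℤ) i : ℤ) : ℂ))) ((fun i : Fin 3 => (((k₂ : Fin 3 → ℤ) i : ℤ) : ℂ))) z hn' hlen' ?_ fun x w hx hw => ?_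
  · -- `z ⊥ k₁ + k₂ = -k₃`
    have hr : (fun i : Fin 3 => (((k₃ : Fin 3 → ℤ) i : ℤ) : ℂ)) ᵥ* Q (-k₃) k₃ = 0 := by
      have := hrow (-k₃) k₃
      rwa [castVec_neg, Matrix.neg_vecMul, neg_eq_zero] at this
    have hk3z : (fun i : Fin 3 => (((k₃ : Fin 3 → ℤ) i : ℤ) : ℂ)) ⬝ᵥ z = 0 := by
      rw [hz, dotProduct_sub, Matrix.dotProduct_mulVec, hr, zero_dotProduct, dotProduct_add, dotProduct_smul,
        dotProduct_smul, dotProduct_comm _ y, hy, dot_self_cross, smul_zero, smul_zero, add_zero, sub_zero]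
    have e : (fun i : Fin 3 => (((k₁ : Fin 3 → ℤ) i : ℤ) : ℂ)) + (fun i : Fin 3 => (((k₂ : Fin 3 → ℤ) i : ℤ) : ℂ)) = -(fun i : Fin 3 => (((k₃ : Fin 3 → ℤ) i : ℤ) : ℂ)) := by rw [hk₃, castVec_neg, castVec_add, neg_neg]
    rw [e, dotProduct_neg, dotProduct_comm, hk3z, neg_zero]
  · -- the triad identity minus the reference identity
    have hP := hpol k₁ k₂ k₃ x w y hk₁ hk₂ (hk₃ ▸ ball_neg hk₁₂) hx hw hy
    have hR := refTriad α β k₁ k₂ k₃ hk₃ x w y hx hw hy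
    rw [hsum] at hP
    have e1 : k₁ + k₃ = -k₂ := by rw [hk₃]; abel
    have e2 : k₂ + k₃ = -k₁ := by rw [hk₃]; abel
    rw [e1, e2, h₂ w hw, h₁ x hx] at hP
    rw [dotProduct_comm, hz, dotProduct_sub]
    linear_combination hP - hR

/-- **THE EQUAL PEELING STEP, one pair.** If `k₁, k₂` are pinned, `k₁ × k₂ ≠ 0` (lengths may be
equal), then the defect of `A_{k₃}`, `k₃ = -(k₁+k₂)`, is orthogonal to the polarisation `k₁ × k₂`.
[folklore] -/
theorem normal_step_of_pair (hpol : (∀ (k₁ k₂ k₃ : Fin 3 → ℤ) (v₁ v₂ v₃ : Fin 3 → ℂ), ((k₁ : Fin 3 → ℤ) ≠ 0 ∧ (k₁) ⬝ᵥ (k₁) ≤ ((N : ℕ) : ℤ) ^ 2) → ((k₂ : Fin 3 → ℤ) ≠ 0 ∧ (k₂) ⬝ᵥ (k₂) ≤ ((N : ℕ) : ℤ) ^ 2) → ((k₃ : Fin 3 → ℤ) ≠ 0 ∧ (k₃) ⬝ᵥ (k₃) ≤ ((N : ℕ) : ℤ) ^ 2) → v₁ ⬝ᵥ (fun i : Fin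 3 => (((k₁ : Fin 3 → ℤ) i : ℤ) : ℂ)) = 0 → v₂ ⬝ᵥ (fun i : Fin 3 => (((k₂ : Fin 3 → ℤ) i : ℤ) : ℂ)) = 0 → v₃ ⬝ᵥ (fun i : Fin 3 => (((k₃ : Fin 3 → ℤ) i : ℤ) : ℂ)) = 0 → (((v₁) ⬝ᵥ (fun i : Fin 3 => (((k₂ : Fin 3 → ℤ) i : ℤ) : ℂ))) • (v₂) + ((v₂) ⬝ᵥ (fun i : Fin 3 => (((k₁ : Fin 3 → ℤ) i : ℤ) : ℂ))) • (v₁) : Fin 3 → ℂ) ⬝ᵥ (Q (k₁ + k₂) k₃ *ᵥ v₃) + (((v₁) ⬝ᵥ (fun i : Fin 3 => (((k₃ : Fin 3 → ℤ) i : ℤ) : ℂ))) • (v₃) + ((v₃) ⬝ᵥ (fun i : Fin 3 => (((k₁ : Fin 3 → ℤ) i : ℤ) : ℂ))) • (v₁) : Fin 3 → ℂ) ⬝ᵥ (Q (k₁ + k₃) k₂ *ᵥ v₂) + (((v₂) ⬝ᵥ (fun i : Fin 3 => (((k₃ : Fin 3 → ℤ) i : ℤ) : ℂ))) • (v₃)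 + ((v₃) ⬝ᵥ (fun i : Fin 3 => (((k₂ : Fin 3 → ℤ) i : ℤ) : ℂ))) • (v₂) : Fin 3 → ℂ) ⬝ᵥ (Q (k₂ + k₃) k₁ *ᵥ v₁) = 0)) {α β : ℂ} {k₁ k₂ : Fin 3 → ℤ}
    (hk₁ : ((k₁ : Fin 3 → ℤ) ≠ 0 ∧ (k₁) ⬝ᵥ (k₁) ≤ ((N : ℕ) : ℤ) ^ 2)) (hk₂ : ((k₂ : Fin 3 → ℤ) ≠ 0 ∧ (k₂) ⬝ᵥ (k₂) ≤ ((N : ℕ) : ℤ) ^ 2)) (hk₁₂ : ((k₁ + k₂ : Fin 3 → ℤ) ≠ 0 ∧ (k₁ + k₂) ⬝ᵥ (k₁ + k₂) ≤ ((N : ℕ) : ℤ) ^ 2)) (hn : k₁ ⨯₃ k₂ ≠ 0)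
    (h₁ : (∀ y : Fin 3 → ℂ, y ⬝ᵥ (fun i : Fin 3 => (((k₁ : Fin 3 → ℤ) i : ℤ) : ℂ)) = 0 → Q (-(k₁)) (k₁) *ᵥ y = (α) • y + (β) • ((fun i : Fin 3 => (((k₁ : Fin 3 → ℤ) i : ℤ) : ℂ)) ⨯₃ y))) (h₂ : (∀ y : Fin 3 → ℂ, y ⬝ᵥ (fun i : Fin 3 => (((k₂ : Fin 3 → ℤ) i : ℤ) : ℂ)) = 0 → Q (-(k₂)) (k₂) *ᵥ y = (α) • y + (β) • ((fun i : Fin 3 => (((k₂ : Fin 3 → ℤ) i : ℤ) : ℂ)) ⨯₃ y))) (y : Fin 3 → ℂ) (hy : y ⬝ᵥ (fun i : Fin 3 => ((((-(k₁ + k₂)) : Fin 3 → ℤ) i : ℤ) : ℂ)) = 0) :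
    (fun i : Fin 3 => ((((k₁ ⨯₃ k₂) : Fin 3 → ℤ) i : ℤ) : ℂ)) ⬝ᵥ (Q (k₁ + k₂) (-(k₁ + k₂)) *ᵥ y - (α • y + β • ((fun i : Fin 3 => ((((-(k₁ + k₂)) : Fin 3 → ℤ) i : ℤ) : ℂ)) ⨯₃ y))) = 0 := by
  set k₃ := -(k₁ + k₂) with hk₃
  -- view the defect as `M *ᵥ y` for the matrix `M = A_{k₃} - α 1 - β [k₃]ₓ` restricted: use the vector form
  set z : Fin 3 → ℂ := Q (k₁ + k₂) k₃ *ᵥ y - (α • y + β • ((fun i : Fin 3 => (((k₃ : Fin 3 → ℤ) i : ℤ) : ℂ)) ⨯₃ y)) with hz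
  -- package `z` as `M *ᵥ y` with `M = of (fun i j => z i * [j = 0])`? Simpler: apply the vector lemma.
  have key : ∀ x w : Fin 3 → ℂ, x ⬝ᵥ (fun i : Fin 3 => (((k₁ : Fin 3 → ℤ) i : ℤ) : ℂ)) = 0 → w ⬝ᵥ (fun i : Fin 3 => (((k₂ : Fin 3 → ℤ) i : ℤ) : ℂ)) = 0 →
      (((x) ⬝ᵥ (fun i : Fin 3 => (((k₂ : Fin 3 → ℤ) i : ℤ) : ℂ))) • (w) + ((w) ⬝ᵥ (fun i : Fin 3 => (((k₁ : Fin 3 → ℤ) i : ℤ) : ℂ))) • (x) : Fin 3 → ℂ) ⬝ᵥ z = 0 := by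
    intro x w hx hw
    have hP := hpol k₁ k₂ k₃ x w y hk₁ hk₂ (ball_neg hk₁₂) hx hw hy
    have hR := refTriad α β k₁ k₂ k₃ hk₃ x w y hx hw hy
    have e1 : k₁ + k₃ = -k₂ := by rw [hk₃]; abel
    have e2 : k₂ + k₃ = -k₁ := by rw [hk₃]; abel
    rw [e1, e2, h₂ w hw, h₁ x hx] at hP
    rw [hz, dotProduct_sub]
    linear_combination hP - hR
  -- now the `normal` computation with `x = n`, `w = k₂ × n`
  set n : Fin 3 → ℂ := (fun i : Fin 3 => (((k₁ : Fin 3 → ℤ) i : ℤ) : ℂ)) ⨯₃ (fun i : Fin 3 => (((k₂ : Fin 3 → ℤ) i : ℤ) : ℂ)) with hndef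
  have hcast : (fun i : Fin 3 => ((((k₁ ⨯₃ k₂) : Fin 3 → ℤ) i : ℤ) : ℂ)) = n := by rw [hndef, castVec_cross_castVec]
  have hnn : n ⬝ᵥ n ≠ 0 := by rw [← hcast]; exact castVec_dotProduct_self_ne_zero hn
  have hna : n ⬝ᵥ (fun i : Fin 3 => (((k₁ : Fin 3 → ℤ) i : ℤ) : ℂ)) = 0 := by rw [hndef, dotProduct_comm]; exact dot_self_cross _ _
  have hnb : n ⬝ᵥ (fun i : Fin 3 => (((k₂ : Fin 3 → ℤ) i : ℤ) : ℂ)) = 0 := by rw [hndef, dotProduct_comm]; exact dot_cross_self _ _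
  have hyb : ((fun i : Fin 3 => (((k₂ : Fin 3 → ℤ) i : ℤ) : ℂ)) ⨯₃ n) ⬝ᵥ (fun i : Fin 3 => (((k₂ : Fin 3 → ℤ) i : ℤ) : ℂ)) = 0 := by rw [dotProduct_comm]; exact dot_self_cross _ _
  have habn : ((fun i : Fin 3 => (((k₂ : Fin 3 → ℤ) i : ℤ) : ℂ)) ⨯₃ n) ⬝ᵥ (fun i : Fin 3 => (((k₁ : Fin 3 → ℤ) i : ℤ) : ℂ)) = n ⬝ᵥ n := by
    rw [dotProduct_comm, triple_product_permutation, triple_product_permutation, hndef]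
  have h1 := key n ((fun i : Fin 3 => (((k₂ : Fin 3 → ℤ) i : ℤ) : ℂ)) ⨯₃ n) hna hyb
  rw [hnb, zero_smul, zero_add, habn, smul_dotProduct, smul_eq_mul] at h1
  rw [hcast]
  rcases mul_eq_zero.1 h1 with h' | h'
  · exact absurd h' hnn
  · exact h'

/-- **THE EQUAL PEELING STEP, two pairs.** Two pinned pairs `(k₁, k₂)`, `(l₁, l₂)` with the same
sum `k`, whose normals `k₁ × k₂`, `l₁ × l₂` and `k` are independent, pin `-k` (hence `k`). [folklore] -/
theorem pinned_of_two_pairs (hrow : ∀ a b, (fun i : Fin 3 => (((a : Fin 3 → ℤ) i : ℤ) : ℂ)) ᵥ* Q a b = 0) (hpol : (∀ (k₁ k₂ k₃ : Fin 3 → ℤ) (v₁ v₂ v₃ : Fin 3 → ℂ), ((k₁ : Fin 3 → ℤ) ≠ 0 ∧ (k₁) ⬝ᵥ (k₁) ≤ ((N : ℕ) : ℤ) ^ 2) → ((k₂ : Fin 3 → ℤ) ≠ 0 ∧ (k₂) ⬝ᵥ (k₂) ≤ ((N : ℕ) : ℤ) ^ 2) → ((k₃ : Fin 3 → ℤ)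 ≠ 0 ∧ (k₃) ⬝ᵥ (k₃) ≤ ((N : ℕ) : ℤ) ^ 2) → v₁ ⬝ᵥ (fun i : Fin 3 => (((k₁ : Fin 3 → ℤ) i : ℤ) : ℂ)) = 0 → v₂ ⬝ᵥ (fun i : Fin 3 => (((k₂ : Fin 3 → ℤ) i : ℤ) : ℂ)) = 0 → v₃ ⬝ᵥ (fun i : Fin 3 => (((k₃ : Fin 3 → ℤ) i : ℤ) : ℂ)) = 0 → (((v₁) ⬝ᵥ (fun i : Fin 3 => (((k₂ : Fin 3 → ℤ) i : ℤ) : ℂ))) • (v₂) + ((v₂) ⬝ᵥ (fun i : Fin 3 => (((k₁ : Fin 3 → ℤ) i : ℤ) : ℂ))) • (v₁) : Fin 3 → ℂ) ⬝ᵥ (Q (k₁ + k₂) k₃ *ᵥ v₃) + (((v₁) ⬝ᵥ (fun i : Fin 3 => (((k₃ : Fin 3 → ℤ) i : ℤ) : ℂ))) • (v₃) + ((v₃) ⬝ᵥ (fun i : Fin 3 => (((k₁ : Fin 3 → ℤ) i : ℤ) : ℂ))) • (v₁) : Fin 3 → ℂ) ⬝ᵥ (Q (k₁ + k₃) k₂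 *ᵥ v₂) + (((v₂) ⬝ᵥ (fun i : Fin 3 => (((k₃ : Fin 3 → ℤ) i : ℤ) : ℂ))) • (v₃) + ((v₃) ⬝ᵥ (fun i : Fin 3 => (((k₂ : Fin 3 → ℤ) i : ℤ) : ℂ))) • (v₂) : Fin 3 → ℂ) ⬝ᵥ (Q (k₂ + k₃) k₁ *ᵥ v₁) = 0)) {α β : ℂ}
    {k₁ k₂ l₁ l₂ : Fin 3 → ℤ} (hk₁ : ((k₁ : Fin 3 → ℤ) ≠ 0 ∧ (k₁) ⬝ᵥ (k₁) ≤ ((N : ℕ) : ℤ) ^ 2)) (hk₂ : ((k₂ : Fin 3 → ℤ) ≠ 0 ∧ (k₂) ⬝ᵥ (k₂) ≤ ((N : ℕ) : ℤ) ^ 2)) (hl₁ : ((l₁ : Fin 3 → ℤ) ≠ 0 ∧ (l₁) ⬝ᵥ (l₁) ≤ ((N : ℕ) : ℤ) ^ 2)) (hl₂ : ((l₂ : Fin 3 → ℤ) ≠ 0 ∧ (l₂) ⬝ᵥ (l₂) ≤ ((N : ℕ) : ℤ) ^ 2))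
    (hk₁₂ : ((k₁ + k₂ : Fin 3 → ℤ) ≠ 0 ∧ (k₁ + k₂) ⬝ᵥ (k₁ + k₂) ≤ ((N : ℕ) : ℤ) ^ 2))
    (hsum : l₁ + l₂ = k₁ + k₂) (hn : k₁ ⨯₃ k₂ ≠ 0) (hm : l₁ ⨯₃ l₂ ≠ 0)
    (hdet : Matrix.det ![k₁ ⨯₃ k₂, l₁ ⨯₃ l₂, k₁ + k₂] ≠ 0)
    (h₁ : (∀ y : Fin 3 → ℂ, y ⬝ᵥ (fun i : Fin 3 => (((k₁ : Fin 3 → ℤ) i : ℤ) : ℂ)) = 0 → Q (-(k₁)) (k₁) *ᵥ y = (α) • y + (β) • ((fun i : Fin 3 => (((k₁ : Fin 3 → ℤ) i : ℤ) : ℂ)) ⨯₃ y))) (h₂ : (∀ y : Fin 3 → ℂ, y ⬝ᵥ (fun i : Fin 3 => (((k₂ : Fin 3 → ℤ) i : ℤ) : ℂ)) = 0 → Q (-(k₂)) (k₂) *ᵥ y = (α) • y + (β) • ((fun i : Fin 3 => (((k₂ : Fin 3 → ℤ) i : ℤ) : ℂ)) ⨯₃ y))) (h₃ : (∀ y : Fin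 3 → ℂ, y ⬝ᵥ (fun i : Fin 3 => (((l₁ : Fin 3 → ℤ) i : ℤ) : ℂ)) = 0 → Q (-(l₁)) (l₁) *ᵥ y = (α) • y + (β) • ((fun i : Fin 3 => (((l₁ : Fin 3 → ℤ) i : ℤ) : ℂ)) ⨯₃ y))) (h₄ : (∀ y : Fin 3 → ℂ, y ⬝ᵥ (fun i : Fin 3 => (((l₂ : Fin 3 → ℤ) i : ℤ) : ℂ)) = 0 → Q (-(l₂)) (l₂) *ᵥ y = (α) • y + (β) • ((fun i : Fin 3 => (((l₂ : Fin 3 → ℤ) i : ℤ) : ℂ)) ⨯₃ y))) :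
    (∀ y : Fin 3 → ℂ, y ⬝ᵥ (fun i : Fin 3 => (((-(k₁ + k₂) : Fin 3 → ℤ) i : ℤ) : ℂ)) = 0 → Q (-(-(k₁ + k₂))) (-(k₁ + k₂)) *ᵥ y = (α) • y + (β) • ((fun i : Fin 3 => (((-(k₁ + k₂) : Fin 3 → ℤ) i : ℤ) : ℂ)) ⨯₃ y)) := by
  intro y hy
  rw [neg_neg]
  have hA := normal_step_of_pair Q hpol hk₁ hk₂ hk₁₂ hn h₁ h₂ y hy
  have hB := normal_step_of_pair Q hpol hl₁ hl₂ (hsum ▸ hk₁₂) hm h₃ h₄ y (by rw [hsum]; exact hy)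
  rw [hsum] at hB
  refine sub_eq_zero.1 (eq_zero_of_three_dotProduct (k₁ ⨯₃ k₂) (l₁ ⨯₃ l₂) (k₁ + k₂) hdet _ hA hB ?_)
  -- `k ⊥ defect`: `kᵀ A_{-k} = 0` up to sign, `k ⊥ y`, `k ⊥ k × y`
  have hr := hrow (k₁ + k₂) (-(k₁ + k₂))
  rw [castVec_neg, dotProduct_neg, neg_eq_zero] at hy
  rw [dotProduct_sub, Matrix.dotProduct_mulVec, hr, zero_dotProduct, dotProduct_add, dotProduct_smul,
    dotProduct_smul, dotProduct_comm _ y, hy, castVec_neg, LinearMap.map_neg₂, dotProduct_neg,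
    dot_self_cross]
  simp

/-- The unequal peeling step, concluding on `k₁ + k₂`. [folklore] -/
theorem pin_sum_unequal (hsymm : ∀ a b, Q b a = (Q a b)ᵀ) (hrow : ∀ a b, (fun i : Fin 3 => (((a : Fin 3 → ℤ) i : ℤ) : ℂ)) ᵥ* Q a b = 0)
    (hcol : ∀ a b, Q a b *ᵥ (fun i : Fin 3 => (((b : Fin 3 → ℤ) i : ℤ) : ℂ)) = 0) (hpol : (∀ (k₁ k₂ k₃ : Fin 3 → ℤ) (v₁ v₂ v₃ : Fin 3 → ℂ), ((k₁ : Fin 3 → ℤ) ≠ 0 ∧ (k₁) ⬝ᵥ (k₁) ≤ ((N : ℕ) : ℤ) ^ 2) → ((k₂ : Fin 3 → ℤ) ≠ 0 ∧ (k₂) ⬝ᵥ (k₂) ≤ ((N : ℕ) : ℤ) ^ 2) → ((k₃ : Fin 3 → ℤ) ≠ 0 ∧ (k₃) ⬝ᵥ (k₃) ≤ ((N : ℕ) : ℤ) ^ 2) → v₁ ⬝ᵥ (fun i : Fin 3 => (((k₁ : Fin 3 → ℤ) i : ℤ) : ℂ)) = 0 → v₂ ⬝ᵥ (fun i : Fin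 3 => (((k₂ : Fin 3 → ℤ) i : ℤ) : ℂ)) = 0 → v₃ ⬝ᵥ (fun i : Fin 3 => (((k₃ : Fin 3 → ℤ) i : ℤ) : ℂ)) = 0 → (((v₁) ⬝ᵥ (fun i : Fin 3 => (((k₂ : Fin 3 → ℤ) i : ℤ) : ℂ))) • (v₂) + ((v₂) ⬝ᵥ (fun i : Fin 3 => (((k₁ : Fin 3 → ℤ) i : ℤ) : ℂ))) • (v₁) : Fin 3 → ℂ) ⬝ᵥ (Q (k₁ + k₂) k₃ *ᵥ v₃) + (((v₁) ⬝ᵥ (fun i : Fin 3 => (((k₃ : Fin 3 → ℤ) i : ℤ) : ℂ))) • (v₃) + ((v₃) ⬝ᵥ (fun i : Fin 3 => (((k₁ : Fin 3 → ℤ) i : ℤ) : ℂ))) • (v₁) : Fin 3 → ℂ) ⬝ᵥ (Q (k₁ + k₃) k₂ *ᵥ v₂) + (((v₂) ⬝ᵥ (fun i : Fin 3 => (((k₃ : Fin 3 → ℤ) i : ℤ) : ℂ))) • (v₃) + ((v₃) ⬝ᵥ (fun i : Fin 3 => (((k₂ : Fin 3 → ℤ) i : ℤ) : ℂ))) • (v₂)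 : Fin 3 → ℂ) ⬝ᵥ (Q (k₂ + k₃) k₁ *ᵥ v₁) = 0)) {α β : ℂ} {k₁ k₂ : Fin 3 → ℤ}
    (hk₁ : ((k₁ : Fin 3 → ℤ) ≠ 0 ∧ (k₁) ⬝ᵥ (k₁) ≤ ((N : ℕ) : ℤ) ^ 2)) (hk₂ : ((k₂ : Fin 3 → ℤ) ≠ 0 ∧ (k₂) ⬝ᵥ (k₂) ≤ ((N : ℕ) : ℤ) ^ 2)) (hk₁₂ : ((k₁ + k₂ : Fin 3 → ℤ) ≠ 0 ∧ (k₁ + k₂) ⬝ᵥ (k₁ + k₂) ≤ ((N : ℕ) : ℤ) ^ 2)) (hn : k₁ ⨯₃ k₂ ≠ 0)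
    (hlen : k₁ ⬝ᵥ k₁ ≠ k₂ ⬝ᵥ k₂) (h₁ : (∀ y : Fin 3 → ℂ, y ⬝ᵥ (fun i : Fin 3 => (((k₁ : Fin 3 → ℤ) i : ℤ) : ℂ)) = 0 → Q (-(k₁)) (k₁) *ᵥ y = (α) • y + (β) • ((fun i : Fin 3 => (((k₁ : Fin 3 → ℤ) i : ℤ) : ℂ)) ⨯₃ y))) (h₂ : (∀ y : Fin 3 → ℂ, y ⬝ᵥ (fun i : Fin 3 => (((k₂ : Fin 3 → ℤ) i : ℤ) : ℂ)) = 0 → Q (-(k₂)) (k₂) *ᵥ y = (α) • y + (β) • ((fun i : Fin 3 => (((k₂ : Fin 3 → ℤ) i : ℤ) : ℂ)) ⨯₃ y))) :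
    (∀ y : Fin 3 → ℂ, y ⬝ᵥ (fun i : Fin 3 => (((k₁ + k₂ : Fin 3 → ℤ) i : ℤ) : ℂ)) = 0 → Q (-(k₁ + k₂)) (k₁ + k₂) *ᵥ y = (α) • y + (β) • ((fun i : Fin 3 => (((k₁ + k₂ : Fin 3 → ℤ) i : ℤ) : ℂ)) ⨯₃ y)) := by
  have h := pinned_neg Q hsymm hcol (neg_ne_zero.2 hk₁₂.1)
    (pinned_of_unequal_pair Q hrow hpol hk₁ hk₂ hk₁₂ hn hlen h₁ h₂)
  rwa [neg_neg] at h

/-- The equal peeling step (two pairs), concluding on `k₁ + k₂`. [folklore] -/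
theorem pin_sum_two_pairs (hsymm : ∀ a b, Q b a = (Q a b)ᵀ) (hrow : ∀ a b, (fun i : Fin 3 => (((a : Fin 3 → ℤ) i : ℤ) : ℂ)) ᵥ* Q a b = 0)
    (hcol : ∀ a b, Q a b *ᵥ (fun i : Fin 3 => (((b : Fin 3 → ℤ) i : ℤ) : ℂ)) = 0) (hpol : (∀ (k₁ k₂ k₃ : Fin 3 → ℤ) (v₁ v₂ v₃ : Fin 3 → ℂ), ((k₁ : Fin 3 → ℤ) ≠ 0 ∧ (k₁) ⬝ᵥ (k₁) ≤ ((N : ℕ) : ℤ) ^ 2) → ((k₂ : Fin 3 → ℤ) ≠ 0 ∧ (k₂) ⬝ᵥ (k₂) ≤ ((N : ℕ) : ℤ) ^ 2) → ((k₃ : Fin 3 → ℤ) ≠ 0 ∧ (k₃) ⬝ᵥ (k₃) ≤ ((N : ℕ) : ℤ) ^ 2) → v₁ ⬝ᵥ (fun i : Fin 3 => (((k₁ : Fin 3 → ℤ) i : ℤ) : ℂ)) = 0 → v₂ ⬝ᵥ (fun i : Fin 3 => (((k₂ : Fin 3 → ℤ) i : ℤ) : ℂ)) = 0 → v₃ ⬝ᵥ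 (fun i : Fin 3 => (((k₃ : Fin 3 → ℤ) i : ℤ) : ℂ)) = 0 → (((v₁) ⬝ᵥ (fun i : Fin 3 => (((k₂ : Fin 3 → ℤ) i : ℤ) : ℂ))) • (v₂) + ((v₂) ⬝ᵥ (fun i : Fin 3 => (((k₁ : Fin 3 → ℤ) i : ℤ) : ℂ))) • (v₁) : Fin 3 → ℂ) ⬝ᵥ (Q (k₁ + k₂) k₃ *ᵥ v₃) + (((v₁) ⬝ᵥ (fun i : Fin 3 => (((k₃ : Fin 3 → ℤ) i : ℤ) : ℂ))) • (v₃) + ((v₃) ⬝ᵥ (fun i : Fin 3 => (((k₁ : Fin 3 → ℤ) i : ℤ) : ℂ))) • (v₁) : Fin 3 → ℂ) ⬝ᵥ (Q (k₁ + k₃) k₂ *ᵥ v₂) + (((v₂) ⬝ᵥ (fun i : Fin 3 => (((k₃ : Fin 3 → ℤ) i : ℤ) : ℂ))) • (v₃) + ((v₃) ⬝ᵥ (fun i : Fin 3 => (((k₂ : Fin 3 → ℤ) i : ℤ) : ℂ))) • (v₂) : Fin 3 → ℂ) ⬝ᵥ (Q (k₂ + k₃) k₁ *ᵥ v₁) =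 0)) {α β : ℂ} {k₁ k₂ l₁ l₂ : Fin 3 → ℤ}
    (hk₁ : ((k₁ : Fin 3 → ℤ) ≠ 0 ∧ (k₁) ⬝ᵥ (k₁) ≤ ((N : ℕ) : ℤ) ^ 2)) (hk₂ : ((k₂ : Fin 3 → ℤ) ≠ 0 ∧ (k₂) ⬝ᵥ (k₂) ≤ ((N : ℕ) : ℤ) ^ 2)) (hl₁ : ((l₁ : Fin 3 → ℤ) ≠ 0 ∧ (l₁) ⬝ᵥ (l₁) ≤ ((N : ℕ) : ℤ) ^ 2)) (hl₂ : ((l₂ : Fin 3 → ℤ) ≠ 0 ∧ (l₂) ⬝ᵥ (l₂) ≤ ((N : ℕ) : ℤ) ^ 2)) (hk₁₂ : ((k₁ + k₂ : Fin 3 → ℤ) ≠ 0 ∧ (k₁ + k₂) ⬝ᵥ (k₁ + k₂) ≤ ((N : ℕ) : ℤ) ^ 2))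
    (hsum : l₁ + l₂ = k₁ + k₂) (hn : k₁ ⨯₃ k₂ ≠ 0) (hm : l₁ ⨯₃ l₂ ≠ 0)
    (hdet : Matrix.det ![k₁ ⨯₃ k₂, l₁ ⨯₃ l₂, k₁ + k₂] ≠ 0)
    (h₁ : (∀ y : Fin 3 → ℂ, y ⬝ᵥ (fun i : Fin 3 => (((k₁ : Fin 3 → ℤ) i : ℤ) : ℂ)) = 0 → Q (-(k₁)) (k₁) *ᵥ y = (α) • y + (β) • ((fun i : Fin 3 => (((k₁ : Fin 3 → ℤ) i : ℤ) : ℂ)) ⨯₃ y))) (h₂ : (∀ y : Fin 3 → ℂ, y ⬝ᵥ (fun i : Fin 3 => (((k₂ : Fin 3 → ℤ) i : ℤ) : ℂ)) = 0 → Q (-(k₂)) (k₂) *ᵥ y = (α) • y + (β) • ((fun i : Fin 3 => (((k₂ : Fin 3 → ℤ) i : ℤ) : ℂ)) ⨯₃ y))) (h₃ : (∀ y : Fin 3 → ℂ, y ⬝ᵥ (fun i : Fin 3 => (((l₁ : Fin 3 → ℤ) i : ℤ) : ℂ)) = 0 → Q (-(l₁)) (l₁) *ᵥ y = (α) • y +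 (β) • ((fun i : Fin 3 => (((l₁ : Fin 3 → ℤ) i : ℤ) : ℂ)) ⨯₃ y))) (h₄ : (∀ y : Fin 3 → ℂ, y ⬝ᵥ (fun i : Fin 3 => (((l₂ : Fin 3 → ℤ) i : ℤ) : ℂ)) = 0 → Q (-(l₂)) (l₂) *ᵥ y = (α) • y + (β) • ((fun i : Fin 3 => (((l₂ : Fin 3 → ℤ) i : ℤ) : ℂ)) ⨯₃ y))) :
    (∀ y : Fin 3 → ℂ, y ⬝ᵥ (fun i : Fin 3 => (((k₁ + k₂ : Fin 3 → ℤ) i : ℤ) : ℂ)) = 0 → Q (-(k₁ + k₂)) (k₁ + k₂) *ᵥ y = (α) • y + (β) • ((fun i : Fin 3 => (((k₁ + k₂ : Fin 3 → ℤ) i : ℤ) : ℂ)) ⨯₃ y)) := by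
  have h := pinned_neg Q hsymm hcol (neg_ne_zero.2 hk₁₂.1)
    (pinned_of_two_pairs Q hrow hpol hk₁ hk₂ hl₁ hl₂ hk₁₂ hsum hn hm hdet h₁ h₂ h₃ h₄)
  rwa [neg_neg] at h

/-- **The generic peeling step of the induction**: if `e` is a unit vector with `k·e > 0`,
`k × e ≠ 0` and `|k|² ≠ 2 k·e`, and every shorter vector of the punctured ball is pinned, then
`k = (k - e) + e` is pinned (unequal step). [folklore] -/
theorem pin_of_peel (hsymm : ∀ a b, Q b a = (Q a b)ᵀ) (hrow : ∀ a b, (fun i : Fin 3 => (((a : Fin 3 → ℤ) i : ℤ) : ℂ)) ᵥ* Q a b = 0)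
    (hcol : ∀ a b, Q a b *ᵥ (fun i : Fin 3 => (((b : Fin 3 → ℤ) i : ℤ) : ℂ)) = 0) (hpol : (∀ (k₁ k₂ k₃ : Fin 3 → ℤ) (v₁ v₂ v₃ : Fin 3 → ℂ), ((k₁ : Fin 3 → ℤ) ≠ 0 ∧ (k₁) ⬝ᵥ (k₁) ≤ ((N : ℕ) : ℤ) ^ 2) → ((k₂ : Fin 3 → ℤ) ≠ 0 ∧ (k₂) ⬝ᵥ (k₂) ≤ ((N : ℕ) : ℤ) ^ 2) → ((k₃ : Fin 3 → ℤ) ≠ 0 ∧ (k₃) ⬝ᵥ (k₃) ≤ ((N : ℕ) : ℤ) ^ 2) → v₁ ⬝ᵥ (fun i : Fin 3 => (((k₁ : Fin 3 → ℤ) i : ℤ) : ℂ)) = 0 → v₂ ⬝ᵥ (fun i : Fin 3 => (((k₂ : Fin 3 → ℤ) i : ℤ) : ℂ)) = 0 → v₃ ⬝ᵥ (fun i : Fin 3 => (((k₃ : Fin 3 → ℤ) i : ℤ) : ℂ)) = 0 → (((v₁) ⬝ᵥ (fun i : Fin 3 => (((k₂ : Fin 3 → ℤ) i : ℤ) : ℂ)))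 • (v₂) + ((v₂) ⬝ᵥ (fun i : Fin 3 => (((k₁ : Fin 3 → ℤ) i : ℤ) : ℂ))) • (v₁) : Fin 3 → ℂ) ⬝ᵥ (Q (k₁ + k₂) k₃ *ᵥ v₃) + (((v₁) ⬝ᵥ (fun i : Fin 3 => (((k₃ : Fin 3 → ℤ) i : ℤ) : ℂ))) • (v₃) + ((v₃) ⬝ᵥ (fun i : Fin 3 => (((k₁ : Fin 3 → ℤ) i : ℤ) : ℂ))) • (v₁) : Fin 3 → ℂ) ⬝ᵥ (Q (k₁ + k₃) k₂ *ᵥ v₂) + (((v₂) ⬝ᵥ (fun i : Fin 3 => (((k₃ : Fin 3 → ℤ) i : ℤ) : ℂ))) • (v₃) + ((v₃) ⬝ᵥ (fun i : Fin 3 => (((k₂ : Fin 3 → ℤ) i : ℤ) : ℂ))) • (v₂) : Fin 3 → ℂ) ⬝ᵥ (Q (k₂ + k₃) k₁ *ᵥ v₁) = 0)) {α β : ℂ} {k e : Fin 3 → ℤ}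
    (hk : ((k : Fin 3 → ℤ) ≠ 0 ∧ (k) ⬝ᵥ (k) ≤ ((N : ℕ) : ℤ) ^ 2)) (he : e ⬝ᵥ e = 1) (hke : 0 < k ⬝ᵥ e) (hcross : k ⨯₃ e ≠ 0)
    (hne : k ⬝ᵥ k ≠ 2 * (k ⬝ᵥ e))
    (ih : ∀ k' : Fin 3 → ℤ, ((k' : Fin 3 → ℤ) ≠ 0 ∧ (k') ⬝ᵥ (k') ≤ ((N : ℕ) : ℤ) ^ 2) → k' ⬝ᵥ k' < k ⬝ᵥ k → (∀ y : Fin 3 → ℂ, y ⬝ᵥ (fun i : Fin 3 => (((k' : Fin 3 → ℤ) i : ℤ) : ℂ)) = 0 → Q (-(k')) (k') *ᵥ y = (α) • y + (β) • ((fun i : Fin 3 => (((k' : Fin 3 → ℤ) i : ℤ) : ℂ)) ⨯₃ y))) :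
    (∀ y : Fin 3 → ℂ, y ⬝ᵥ (fun i : Fin 3 => (((k : Fin 3 → ℤ) i : ℤ) : ℂ)) = 0 → Q (-(k)) (k) *ᵥ y = (α) • y + (β) • ((fun i : Fin 3 => (((k : Fin 3 → ℤ) i : ℤ) : ℂ)) ⨯₃ y)) := by
  have hke' : (k - e) ⬝ᵥ (k - e) = k ⬝ᵥ k - 2 * (k ⬝ᵥ e) + 1 := by
    simp only [sub_dotProduct, dotProduct_sub, dotProduct_comm e k, he]; ring
  have hkpos : 0 < k ⬝ᵥ k := dotProduct_self_pos_of_ne_zero_int hk.1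
  have hene : e ≠ 0 := fun h => by simp [h] at he
  have heball : ((e : Fin 3 → ℤ) ≠ 0 ∧ (e) ⬝ᵥ (e) ≤ ((N : ℕ) : ℤ) ^ 2) := ⟨hene, by rw [he]; linarith [hk.2]⟩
  have hkme : k - e ≠ 0 := fun h => hcross (by rw [sub_eq_zero.1 h, cross_self])
  have hkmeball : ((k - e : Fin 3 → ℤ) ≠ 0 ∧ (k - e) ⬝ᵥ (k - e) ≤ ((N : ℕ) : ℤ) ^ 2) := ⟨hkme, by rw [hke']; linarith [hk.2]⟩
  have hlt1 : (k - e) ⬝ᵥ (k - e) < k ⬝ᵥ k := by rw [hke']; linarith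
  have hlt2 : e ⬝ᵥ e < k ⬝ᵥ k := by
    rw [he]
    by_contra hle
    have hpos := dotProduct_self_pos_of_ne_zero_int hkme
    rw [hke'] at hpos
    push Not at hle
    linarith
  have h₁ := ih (k - e) hkmeball hlt1
  have h₂ := ih e heball hlt2
  have hn : (k - e) ⨯₃ e ≠ 0 := by rwa [LinearMap.map_sub₂, cross_self, sub_zero]
  have hlen : (k - e) ⬝ᵥ (k - e) ≠ e ⬝ᵥ e := by
    rw [hke', he]; intro h; exact hne (by linarith)
  have h := pin_sum_unequal Q hsymm hrow hcol hpol hkmeball heball (by rwa [sub_add_cancel]) hn hlen h₁ h₂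
  rwa [sub_add_cancel] at h

end Summit.AnomalousDissipation.AnomalousDissipation.Theorems.MomentParityQuarticGate.AxialQuad

namespace Summit.AnomalousDissipation.AnomalousDissipation.Theorems.MomentParityQuarticGate

-- the summit-side namespace repeats `AnomalousDissipation` by the tree's convention
set_option linter.dupNamespace false in
/-- **Registered sub-goal `axialQuad_peel` of stub S2q** (summary of this file): the generic peeling step of the centre induction — `k = (k - e) + e` is pinned once all shorter vectors are. [folklore] -/
theorem axialQuad_peel : ∀ (Q : ((Fin 3 → ℤ) → (Fin 3 → ℤ) → Matrix (Fin 3) (Fin 3) ℂ)) (N : ℕ), (∀ a b : Fin 3 → ℤ, Q b a = Matrix.transpose (Q a b)) → (∀ a b : Fin 3 → ℤ, Matrix.vecMul (fun i : Fin 3 => (((a : Fin 3 → ℤ) i : ℤ) : ℂ)) (Q a b) = 0) → (∀ a b : Fin 3 → ℤ, Matrix.mulVec (Q a b) (fun i : Fin 3 => (((b : Fin 3 → ℤ) i : ℤ) : ℂ)) = 0) → (∀ (k₁ k₂ k₃ : Fin 3 → ℤ) (v₁ v₂ v₃ : Fin 3 → ℂ), ((k₁ : Fin 3 → ℤ) ≠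 0 ∧ (k₁) ⬝ᵥ (k₁) ≤ ((N : ℕ) : ℤ) ^ 2) → ((k₂ : Fin 3 → ℤ) ≠ 0 ∧ (k₂) ⬝ᵥ (k₂) ≤ ((N : ℕ) : ℤ) ^ 2) → ((k₃ : Fin 3 → ℤ) ≠ 0 ∧ (k₃) ⬝ᵥ (k₃) ≤ ((N : ℕ) : ℤ) ^ 2) → v₁ ⬝ᵥ (fun i : Fin 3 => (((k₁ : Fin 3 → ℤ) i : ℤ) : ℂ)) = 0 → v₂ ⬝ᵥ (fun i : Fin 3 => (((k₂ : Fin 3 → ℤ) i : ℤ) : ℂ)) = 0 → v₃ ⬝ᵥ (fun i : Fin 3 => (((k₃ : Fin 3 → ℤ) i : ℤ) : ℂ)) = 0 → (((v₁) ⬝ᵥ (fun i : Fin 3 => (((k₂ : Fin 3 → ℤ) i : ℤ) : ℂ))) • (v₂) + ((v₂) ⬝ᵥ (fun i : Fin 3 => (((k₁ : Fin 3 → ℤ) i : ℤ) : ℂ))) • (v₁) : Fin 3 → ℂ) ⬝ᵥ (Matrix.mulVec (Q (k₁ + k₂) k₃) v₃) + (((v₁) ⬝ᵥ (fun i : Fin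 3 => (((k₃ : Fin 3 → ℤ) i : ℤ) : ℂ))) • (v₃) + ((v₃) ⬝ᵥ (fun i : Fin 3 => (((k₁ : Fin 3 → ℤ) i : ℤ) : ℂ))) • (v₁) : Fin 3 → ℂ) ⬝ᵥ (Matrix.mulVec (Q (k₁ + k₃) k₂) v₂) + (((v₂) ⬝ᵥ (fun i : Fin 3 => (((k₃ : Fin 3 → ℤ) i : ℤ) : ℂ))) • (v₃) + ((v₃) ⬝ᵥ (fun i : Fin 3 => (((k₂ : Fin 3 → ℤ) i : ℤ) : ℂ))) • (v₂) : Fin 3 → ℂ) ⬝ᵥ (Matrix.mulVec (Q (k₂ + k₃) k₁) v₁) = 0) → ∀ (α β : ℂ) (k e : Fin 3 → ℤ), ((k : Fin 3 → ℤ) ≠ 0 ∧ (k) ⬝ᵥ (k) ≤ ((N : ℕ) : ℤ) ^ 2) → e ⬝ᵥ e = 1 → 0 < k ⬝ᵥ e → crossProduct k e ≠ 0 → k ⬝ᵥ k ≠ 2 * (k ⬝ᵥ e) → (∀ k' : Fin 3 → ℤ, ((k' : Fin 3 → ℤ) ≠ 0 ∧ (k') ⬝ᵥ (k') ≤ ((N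 : ℕ) : ℤ) ^ 2) → k' ⬝ᵥ k' < k ⬝ᵥ k → (∀ y : Fin 3 → ℂ, y ⬝ᵥ (fun i : Fin 3 => (((k' : Fin 3 → ℤ) i : ℤ) : ℂ)) = 0 → Matrix.mulVec (Q (-(k')) (k')) y = (α) • y + (β) • (crossProduct (fun i : Fin 3 => (((k' : Fin 3 → ℤ) i : ℤ) : ℂ)) y))) → (∀ y : Fin 3 → ℂ, y ⬝ᵥ (fun i : Fin 3 => (((k : Fin 3 → ℤ) i : ℤ) : ℂ)) = 0 → Matrix.mulVec (Q (-(k)) (k)) y = (α) • y + (β) • (crossProduct (fun i : Fin 3 => (((k : Fin 3 → ℤ) i : ℤ) : ℂ)) y)) :=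
  fun Q _ hsymm hrow hcol hpol _ _ _ _ hk he hke hcross hne ih => AxialQuad.pin_of_peel Q hsymm hrow hcol hpol hk he hke hcross hne ih

end Summit.AnomalousDissipation.AnomalousDissipation.Theorems.MomentParityQuarticGate
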